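import Literature.Computability.Complexity.YatesMachineJoin
import Literature.Computability.Complexity.StackMachinesTM2
import HarnessLib

/-!
# The evaluation machine of Williams' Lemma 4.2, V: output, assembly, running time — Lemma 4.2

Literature / circuit complexity, the last file of the series `YatesMachineSetup` (bank,
parsing, masks) → `YatesMachineTables` (cube, multiplicity table) → `YatesMachineZeta` (zeta
rounds) → `YatesMachineJoin` (reading the gate by sorting) → this file, which PROVES Williams'
**evaluation lemma** (R. Williams, *Nonuniform ACC circuit lower bounds*, J. ACM 61 (2014),
Lemma 4.2) about Mathlib's multi-stack machines:

* **Phase 6** `outProg` / `runs_outProg`: from the output records (point, bit) in the order of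
  the points, the bits are written in order onto `out` — `truthTable S.eval`
  (`truthTable_eval_eq`, `YatesTables.lean`) — and the counters are dropped;
* `yatesProg` and **`runs_yatesProg`**: the seven phases chained; from the file with
  `encodeSymPlus S` on `inp` to the file with `truthTable S.eval` on `out`, everything else
  empty, within `totalCost S` steps; `machine` (compiled by `StackMachinesTM2.lean`) and
  `machine_outputsWithin`;
* the time analysis: `lt_two_pow_width` (`s < 2^{|bin s|}`, the field width suffices),
  `width_le_of_lt_two_pow` (`|bin s| ≤ n + 1` unless `s ≥ 2^{n+1}`; canonical numerals end in
  a `1`), `length_symPlusCodeList`, `monomial_bounds`, `le_shape` and **`totalCost_le`**: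
  `totalCost S + 1 ≤ 30000 · (2ⁿ + s³)(n+1)³` (the products `2ⁿ · b`, `2ⁿ · b²` of table size
  and field width are `≤ 2ⁿ (n+1)²` or `≤ s³` according as `b ≤ n + 1` or `2ⁿ ≤ s`);
* **`Williams2014_lemma_4_2_strong`** — one machine, every `SYM⁺` circuit, time
  `c (2ⁿ + s^c)(n+1)^c + c` (the hypothesis `hE` of `Williams2014_thm_4_1_of_machines`) — and
  the discharge **`Williams2014_lemma_4_2_holds`** of the named fact of
  `Williams2014AccSat.lean`.

## References

* R. Williams, *Nonuniform ACC circuit lower bounds*, J. ACM 61(1) (2014) 2:1–2:32, Lemma 4.2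
  with Proof 2 (Yates) and App. C [Williams2014].
* F. Yates, *The Design and Analysis of Factorial Experiments*, 1937; D. E. Knuth, TAOCP Vol. 2,
  §4.6.4, and Vol. 3, §5.2.5.
-/

namespace Literature.Computability.Complexity

open SProg Com _root_.Computability Finset MetaComplexity Turing

namespace YatesM

open RRF YRF

variable {n : ℕ}

/-! ### Phase 6: writing the truth table -/

/-- The body of the output pass: read an output record, drop the point, push its bit onto `Y`.
[folklore] -/
def outBody : Com YReg :=
  readItemTo iL iA iw it ;; (dropBits iA oN iV ;; pour iV oN) ;; pop iA (push oY true) (push oY false) skip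

/-- Effect of `outBody` on the record of `T`: `19 n + 25` steps. [folklore] -/
theorem runs_outBody (S : SymPlus n) (T : ℕ) (rest : List Bool) (ρ : RRF) (σ : YRF)
    (hL : ρ.L = dbl (outRec S T) ++ false :: true :: rest) (hA : ρ.A = []) (hw : ρ.w = []) (ht : ρ.t = [])
    (hV : ρ.V = []) (hN : σ.N = List.replicate n true) :
    Runs outBody (est ρ σ) (est { ρ with L := rest } { σ with Y := S.sym (gVal S T) :: σ.Y }) (19 * n + 25) := by
  set ρ₁ : RRF := { ρ with L := rest, A := outRec S T } with hρ₁
  have h1 : Runs (readItemTo iL iA iw it) (est ρ σ) (est ρ₁ σ) (11 * (n + 1) + 9) := by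
    have h := runs_readItemTo (L := iL) (A := iA) (w := iw) (t := it) (by decide) (by decide) (by decide)
      (by decide) (by decide) (outRec S T) rest (est ρ σ) (by simp [hL]) (by simp [hw]) (by simp [ht])
    rw [show (outRec S T).length = n + 1 by simp [outRec]] at h
    refine h.of_eq ?_ le_rfl
    simp only [hρ₁]; simp [hA]
  set ρ₂ : RRF := { ρ₁ with A := [S.sym (gVal S T)], V := List.replicate n true } with hρ₂
  set σ₂ : YRF := { σ with N := [] } with hσ₂
  have h2 : Runs (dropBits iA oN iV) (est ρ₁ σ) (est ρ₂ σ₂) (5 * n + 1) := by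
    have h := runs_dropBits (A := iA) (U := oN) (V := iV) (by decide) (by decide) (by decide) n (est ρ₁ σ) (by simp [hN])
    refine h.of_eq ?_ le_rfl
    simp only [hρ₂, hρ₁, hσ₂]; simp [hV, outRec]
  set ρ₃ : RRF := { ρ₂ with V := [] } with hρ₃
  have h3 : Runs (pour iV oN) (est ρ₂ σ₂) (est ρ₃ σ) (3 * n + 1) := by
    have h := runs_pour (a := iV) (b := oN) (by decide) (est ρ₂ σ₂)
    rw [show (est ρ₂ σ₂ iV).length = n by simp [hρ₂]] at h
    refine h.of_eq ?_ le_rfl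
    simp only [hρ₃, hρ₂, hσ₂]; obtain ⟨⟩ := σ; simp only at hN ⊢; simp [hN]
  set ρ₄ : RRF := { ρ₃ with A := [] } with hρ₄
  have h4 : Runs (pop iA (push oY true) (push oY false) skip) (est ρ₃ σ) (est ρ₄ { σ with Y := S.sym (gVal S T) :: σ.Y }) 3 := by
    cases hs : S.sym (gVal S T) with
    | true =>
      refine (Runs.pop_true _ _ (w := []) (by simp [hρ₃, hρ₂, hs]) (Runs.push oY true _)).of_eq ?_ (by rfl)
      simp only [hρ₄, hρ₃, hρ₂, hρ₁]; simp
    | false =>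
      refine (Runs.pop_false _ _ (w := []) (by simp [hρ₃, hρ₂, hs]) (Runs.push oY false _)).of_eq ?_ (by rfl)
      simp only [hρ₄, hρ₃, hρ₂, hρ₁]; simp
  refine (h1.seq ((h2.seq h3).seq h4)).of_eq ?_ (by omega)
  simp only [hρ₄, hρ₃, hρ₂, hρ₁, hA, hV]

/-- **The output pass**: the bits of the records are pushed onto `Y` (reversed). [folklore] -/
theorem runs_outPass (S : SymPlus n) (Ts : List ℕ) (ρ : RRF) (σ : YRF) (hL : ρ.L = encList (Ts.map (outRec S)))
    (hA : ρ.A = []) (hw : ρ.w = []) (ht : ρ.t = []) (hV : ρ.V = []) (hN : σ.N = List.replicate n true) :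
    Runs (streamLoop iL iw outBody) (est ρ σ)
      (est { ρ with L := [] } { σ with Y := (Ts.map fun T => S.sym (gVal S T)).reverse ++ σ.Y })
      ((Ts.map fun _ => 19 * n + 25).sum + 6 * Ts.length + 4) := by
  let P : List ℕ → Regs YReg → Prop := fun l R => ∃ done, Ts = done ++ l ∧
    R = est { ρ with L := encList (l.map (outRec S)) } { σ with Y := (done.map fun T => S.sym (gVal S T)).reverse ++ σ.Y }
  have hbody : ∀ (a : ℕ) (l : List ℕ) (R : Regs YReg), P (a :: l) R → R iL = encList ((a :: l).map (outRec S)) →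
      R iw = [] → ∃ R', Runs outBody R R' (19 * n + 25) ∧ R' iL = encList (l.map (outRec S)) ∧ R' iw = [] ∧ P l R' := by
    rintro a l R ⟨done, hdone, rfl⟩ - -
    refine ⟨_, runs_outBody S a (encList (l.map (outRec S))) _ _ (by simp [encList_cons_eq_dbl]) (by simp [hA])
      (by simp [hw]) (by simp [ht]) (by simp [hV]) (by simp [hN]), by simp, by simp [hw], done ++ [a], by simp [hdone], ?_⟩
    simp
  obtain ⟨R', hloop, -, -, ⟨done, hdone, rfl⟩⟩ := runs_streamLoop (L := iL) (w := iw) (by decide)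
    (fun l => encList (l.map (outRec S))) rfl (fun a l => by simpa using encList_cons_ne_nil _ _)
    P (fun _ => 19 * n + 25) hbody Ts (est ρ σ)
    ⟨[], by simp, by obtain ⟨⟩ := ρ; obtain ⟨⟩ := σ; simp only at hL ⊢; simp [hL]⟩ (by simp [hL]) (by simp [hw])
  rw [List.append_nil] at hdone
  subst hdone
  exact hloop.of_eq (by simp) le_rfl

/-- `outProg`: the output pass, the bits poured onto `out` (in order), the counters dropped.
[folklore] -/
def outProg : Com YReg := streamLoop iL iw outBody ;; pour oY oOut ;; clear oN ;; clear oBw ;; clear oAcc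

/-- The cost of the output phase. [folklore] -/
def outCost (n b : ℕ) : ℕ := (2 ^ n * (19 * n + 25) + 6 * 2 ^ n + 4) + (3 * 2 ^ n + 1) + (2 * n + 1) + (2 * b + 1) + (2 * b + 1)

/-- **Effect of the output phase**: `out := truthTable S.eval`, the work registers emptied.
[cite: Williams2014, Lemma 4.2] -/
theorem runs_outProg (S : SymPlus n) (b : ℕ) (ρ : RRF) (σ : YRF)
    (hL : ρ.L = encList ((List.range (2 ^ n)).map (outRec S))) (hA : ρ.A = []) (hw : ρ.w = []) (ht : ρ.t = [])
    (hV : ρ.V = []) (hN : σ.N = List.replicate n true) (hY : σ.Y = []) (hout : σ.out = [])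
    (hBw : σ.Bw = List.replicate b true) (hacc : σ.acc.length = b) :
    Runs outProg (est ρ σ) (est { ρ with L := [] } { σ with out := truthTable S.eval, N := [], Bw := [], acc := [] })
      (outCost n b) := by
  have htt : truthTable S.eval = (List.range (2 ^ n)).map fun T => S.sym (gVal S T) := by
    rw [truthTable_eval_eq]; rfl
  have h1 := runs_outPass S (List.range (2 ^ n)) ρ σ hL hA hw ht hV hN
  simp only [List.map_const', List.sum_replicate, smul_eq_mul, List.length_range, hY, List.append_nil] at h1
  set ρ₁ : RRF := { ρ with L := [] } with hρ₁
  set σ₁ : YRF := { σ with Y := ((List.range (2 ^ n)).map fun T => S.sym (gVal S T)).reverse } with hσ₁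
  set σ₂ : YRF := { σ with Y := [], out := truthTable S.eval } with hσ₂
  have h2 : Runs (pour oY oOut) (est ρ₁ σ₁) (est ρ₁ σ₂) (3 * 2 ^ n + 1) := by
    have h := runs_pour (a := oY) (b := oOut) (by decide) (est ρ₁ σ₁)
    rw [show (est ρ₁ σ₁ oY).length = 2 ^ n by simp [hσ₁]] at h
    refine h.of_eq ?_ le_rfl
    simp only [hσ₂, hσ₁, htt]; simp [hout]
  set σ₃ : YRF := { σ₂ with N := [] } with hσ₃
  have h3 : Runs (clear oN) (est ρ₁ σ₂) (est ρ₁ σ₃) (2 * n + 1) := by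
    have h := runs_clear oN (est ρ₁ σ₂)
    rw [show (est ρ₁ σ₂ oN).length = n by simp [hσ₂, hN]] at h
    exact h.of_eq (by simp only [hσ₃, update_est_inr, update_N]) le_rfl
  set σ₄ : YRF := { σ₃ with Bw := [] } with hσ₄
  have h4 : Runs (clear oBw) (est ρ₁ σ₃) (est ρ₁ σ₄) (2 * b + 1) := by
    have h := runs_clear oBw (est ρ₁ σ₃)
    rw [show (est ρ₁ σ₃ oBw).length = b by simp [hσ₃, hσ₂, hBw]] at h
    exact h.of_eq (by simp only [hσ₄, update_est_inr, update_Bw]) le_rfl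
  set σ₅ : YRF := { σ₄ with acc := [] } with hσ₅
  have h5 : Runs (clear oAcc) (est ρ₁ σ₄) (est ρ₁ σ₅) (2 * b + 1) := by
    have h := runs_clear oAcc (est ρ₁ σ₄)
    rw [show (est ρ₁ σ₄ oAcc).length = b by simp [hσ₄, hσ₃, hσ₂, hacc]] at h
    exact h.of_eq (by simp only [hσ₅, update_est_inr, update_acc]) le_rfl
  have H := (h1.of_eq (by simp only [hρ₁, hσ₁]) le_rfl).seq (h2.seq (h3.seq (h4.seq h5)))
  refine H.of_eq ?_ (by unfold outCost; omega)
  simp only [hσ₅, hσ₄, hσ₃, hσ₂, hρ₁, hY]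

/-! ### The whole machine -/

/-- **The evaluation machine** of Williams' Lemma 4.2 as a structured stack program: parse,
mask words, cube, multiplicity table, zeta rounds, join with the gate table, output.
[cite: Williams2014, Lemma 4.2 (Proof 2, App. C)] -/
def yatesProg : Com YReg :=
  parseProg ;; masksProg ;; enumProg ;; fTableProg ;; zetaProg ;; joinProg ;; outProg

/-- The field width used by the machine: the length of the binary numeral of `s`. [folklore] -/
def width (s : ℕ) : ℕ := (encodeNat s).length

/-- Canonical numerals of positive numbers end in a `1`. [folklore] -/
theorem encodePosNum_eq_append_true (p : PosNum) : ∃ l : List Bool, encodePosNum p = l ++ [true] := by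
  induction p with
  | one => exact ⟨[], rfl⟩
  | bit0 p ih => obtain ⟨l, hl⟩ := ih; exact ⟨false :: l, by simp [encodePosNum, hl]⟩
  | bit1 p ih => obtain ⟨l, hl⟩ := ih; exact ⟨true :: l, by simp [encodePosNum, hl]⟩

/-- **`s < 2^{|bin s|}`** (the field width suffices for the counts). [folklore] -/
theorem lt_two_pow_width (s : ℕ) : s < 2 ^ width s := by
  have h := bitsToNat_lt (encodeNat s)
  rwa [bitsToNat_encodeNat] at h

/-- **`|bin s| ≤ k` if `s < 2ᵏ`** (numerals carry no leading zeros). [folklore] -/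
theorem width_le_of_lt_two_pow {s k : ℕ} (h : s < 2 ^ k) : width s ≤ k := by
  by_contra hk
  rw [not_le] at hk
  -- `encodeNat s` is nonempty, ends in `true`, so `s ≥ 2^(width s - 1) ≥ 2^k`
  have hs0 : s ≠ 0 := by
    rintro rfl
    have : width 0 = 0 := rfl
    omega
  obtain ⟨p, hp⟩ : ∃ p : PosNum, (s : Num) = Num.pos p := by
    cases hsn : (s : Num) with
    | zero => exfalso; exact hs0 (by simpa using congrArg (fun x : Num => (x : ℕ)) hsn)
    | pos p => exact ⟨p, rfl⟩
  obtain ⟨l, hl⟩ := encodePosNum_eq_append_true p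
  have henc : encodeNat s = l ++ [true] := by
    change encodeNum (s : Num) = _; rw [hp]; exact hl
  have hval : s = bitsToNat l + 2 ^ l.length := by
    have := bitsToNat_encodeNat s
    rw [henc, bitsToNat_append] at this
    simpa using this.symm
  have hw : width s = l.length + 1 := by simp [width, henc]
  have : 2 ^ k ≤ 2 ^ l.length := Nat.pow_le_pow_right two_pos (by omega)
  omega

/-- The total cost of the machine on `S` (before the final `+ 1` of the compiled run). [folklore] -/
def totalCost (S : SymPlus n) : ℕ :=
  parseCost (symPlusCodeList S).length n S.size + (S.terms.length * (termBound n + 2) + 1) + enumCost n +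
    fTableCost n (width S.size) S.size + zetaCost n (width S.size) + joinCost n (width S.size) S.size +
    outCost n (width S.size)

/-- **Correctness of the evaluation machine**: started with the code of `S` on `inp` and all
other registers empty, `yatesProg` ends with `truthTable S.eval` on `out` and all other
registers empty, within `totalCost S` steps. [cite: Williams2014, Lemma 4.2] -/
theorem runs_yatesProg (S : SymPlus n) :
    Runs yatesProg (est lclean { YRF.empty with inp := encodeSymPlus S })
      (est lclean { YRF.empty with out := truthTable S.eval }) (totalCost S) := by
  set b := width S.size with hb
  set σ₀ : YRF := { YRF.empty with inp := encodeSymPlus S } with hσ₀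
  -- Phase 0
  set σ₁ : YRF := { σ₀ with
    inp := encList (bodyItems S), N := List.replicate n true
    Bw := List.replicate b true, Sc := List.replicate S.size true } with hσ₁
  have h1 : Runs parseProg (est lclean σ₀) (est lclean σ₁) (parseCost (symPlusCodeList S).length n S.size) :=
    runs_parseProg S lclean σ₀ rfl rfl rfl (by simp [hσ₀]) (by simp [hσ₀]) (by simp [hσ₀]) (by simp [hσ₀]) (by simp [hσ₀])
      (by simp [hσ₀])
  -- Phase 1
  set σ₂ : YRF := { σ₁ with inp := encList (tableItems S), Sc := [], M := outRev (S.terms.map tagMask) } with hσ₂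
  have h2 : Runs masksProg (est lclean σ₁) (est lclean σ₂) (S.terms.length * (termBound n + 2) + 1) := by
    have h := runs_masksProg S.terms [] (tableItems S) lclean σ₁ (by simp [hσ₁, bodyItems_eq]) rfl rfl rfl
      (by simp [hσ₁, hσ₀]) (by simp [hσ₁, hσ₀]) (by simp [hσ₁, hσ₀]) (by simp [hσ₁, hσ₀]) (by simp [hσ₁, hσ₀])
      (by simp [hσ₁]) (by simp [hσ₁, hσ₀]) (by simp [hσ₁, SymPlus.size])
    exact h.of_eq (by simp only [hσ₂, List.nil_append]; rfl) le_rfl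
  -- Phase 2
  set ρ₃ : RRF := { lclean with L := encList (enumWords n) } with hρ₃
  set σ₃ : YRF := { σ₂ with Ek := encList (enumWords n) } with hσ₃
  have h3 : Runs enumProg (est lclean σ₂) (est ρ₃ σ₃) (enumCost n) :=
    runs_enumProg n lclean σ₂ rfl rfl rfl rfl rfl rfl rfl (by simp [hσ₂, hσ₁, hσ₀]) (by simp [hσ₂, hσ₁])
      (by simp [hσ₂, hσ₁, hσ₀]) (by simp [hσ₂, hσ₁, hσ₀])
  -- Phase 3
  set ρ₄ : RRF := { ρ₃ with L := encList ((fTable S).map (natToWord b)) } with hρ₄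
  set σ₄ : YRF := { σ₃ with M := [] } with hσ₄
  have h4 : Runs fTableProg (est ρ₃ σ₃) (est ρ₄ σ₄) (fTableCost n b S.size) :=
    runs_fTableProg S b ρ₃ σ₃ rfl rfl rfl rfl rfl rfl rfl rfl rfl rfl (by simp [hσ₃, hσ₂]) (by simp [hσ₃, hσ₂, hσ₁])
      (by simp [hσ₃, hσ₂, hσ₁, hσ₀]) (by simp [hσ₃, hσ₂, hσ₁, hσ₀]) (by simp [hσ₃, hσ₂, hσ₁]) (by simp [hσ₃, hσ₂, hσ₁, hσ₀])
  -- Phase 4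
  set ρ₅ : RRF := { ρ₄ with L := encList ((gTable S n).map (natToWord b)) } with hρ₅
  have h5 : Runs zetaProg (est ρ₄ σ₄) (est ρ₅ σ₄) (zetaCost n b) :=
    runs_zetaProg S b ρ₄ σ₄ rfl rfl rfl rfl rfl rfl rfl (by simp [hσ₄, hσ₃, hσ₂, hσ₁, hσ₀]) (by simp [hσ₄, hσ₃, hσ₂, hσ₁, hσ₀])
      (by simp [hσ₄, hσ₃, hσ₂, hσ₁, hσ₀]) (by simp [hσ₄, hσ₃, hσ₂, hσ₁, hσ₀]) (by simp [hσ₄, hσ₃, hσ₂, hσ₁, hσ₀])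
      (by simp [hσ₄, hσ₃, hσ₂, hσ₁]) (by simp [hσ₄, hσ₃, hσ₂, hσ₁, hσ₀])
  -- Phase 5
  set ρ₆ : RRF := { ρ₅ with L := encList ((List.range (2 ^ n)).map (outRec S)) } with hρ₆
  set σ₆ : YRF := { σ₄ with Ek := [], inp := [], acc := natToWord b (S.size + 1) } with hσ₆
  have h6 : Runs joinProg (est ρ₅ σ₄) (est ρ₆ σ₆) (joinCost n b S.size) :=
    runs_joinProg S (b := b) (lt_two_pow_width S.size) ρ₅ σ₄ rfl rfl rfl rfl rfl rfl rfl rfl rfl rfl (by simp [hσ₄, hσ₃])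
      (by simp [hσ₄, hσ₃, hσ₂]) (by simp [hσ₄, hσ₃, hσ₂, hσ₁, hσ₀]) (by simp [hσ₄, hσ₃, hσ₂, hσ₁])
      (by simp [hσ₄, hσ₃, hσ₂, hσ₁]) (by simp [hσ₄, hσ₃, hσ₂, hσ₁, hσ₀]) (by simp [hσ₄, hσ₃, hσ₂, hσ₁, hσ₀])
      (by simp [hσ₄, hσ₃, hσ₂, hσ₁, hσ₀])
  -- Phase 6
  set σ₇ : YRF := { σ₆ with out := truthTable S.eval, N := [], Bw := [], acc := [] } with hσ₇
  have h7 : Runs outProg (est ρ₆ σ₆) (est lclean σ₇) (outCost n b) := by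
    have h := runs_outProg S b ρ₆ σ₆ rfl rfl rfl rfl rfl (by simp [hσ₆, hσ₄, hσ₃, hσ₂, hσ₁]) (by simp [hσ₆, hσ₄, hσ₃, hσ₂, hσ₁, hσ₀])
      (by simp [hσ₆, hσ₄, hσ₃, hσ₂, hσ₁, hσ₀]) (by simp [hσ₆, hσ₄, hσ₃, hσ₂, hσ₁]) (by simp [hσ₆])
    exact h.of_eq (by simp only [hσ₇, hρ₆, hρ₅, hρ₄, hρ₃]; rfl) le_rfl
  have H := h1.seq (h2.seq (h3.seq (h4.seq (h5.seq (h6.seq h7)))))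
  refine H.of_eq ?_ (by unfold totalCost; rw [← hb]; omega)
  simp only [hσ₇, hσ₆, hσ₄, hσ₃, hσ₂, hσ₁, hσ₀]
  rfl

/-! ### The compiled machine -/

/-- The initial file of a run is the machine's file with the input on `inp`. [folklore] -/
theorem init_inp_eq (x : List Bool) : Regs.init oInp x = est lclean { YRF.empty with inp := x } := by
  funext i; rcases i with i | i <;> cases i <;> rfl

/-- The final file of a run is the machine's file with the output on `out`. [folklore] -/
theorem init_out_eq (x : List Bool) : Regs.init oOut x = est lclean { YRF.empty with out := x } := by
  funext i; rcases i with i | i <;> cases i <;> rfl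

/-- **The evaluation machine as a `TM2` machine** (compiled by `StackMachinesTM2.lean`).
[cite: Williams2014, Lemma 4.2] -/
noncomputable def machine : TM2ComputableAux Bool Bool :=
  (Com.compile (yatesProg.map (Fintype.equivFin YReg))).toAux (Fintype.equivFin YReg oInp)
    (Fintype.equivFin YReg oOut)

/-- The compiled machine outputs the truth table within `totalCost S + 1` steps. [cite: Williams2014, Lemma 4.2] -/
theorem machine_outputsWithin (S : SymPlus n) :
    machine.OutputsWithin (encodeSymPlus S) (truthTable S.eval) (totalCost S + 1) := by
  have h := runs_yatesProg S
  rw [← init_inp_eq, ← init_out_eq] at h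
  exact Com.outputsWithin_of_runs_equiv (Fintype.equivFin YReg) (Or.inl h)

/-! ### The running time is `(2ⁿ + poly(s)) · poly(n)` -/

/-- The number of naturals in the code of `S`: `n`, `s`, per term its size and variables, the
`s + 1` table values. [folklore] -/
theorem length_symPlusCodeList (S : SymPlus n) :
    (symPlusCodeList S).length ≤ S.size * (n + 2) + 3 := by
  have hcard : ∀ t : Finset (Fin n), t.card ≤ n := fun t => (Finset.card_le_univ t).trans (by simp)
  simp only [symPlusCodeList, List.length_cons, List.length_append, List.length_flatMap, List.length_map,
    List.length_range, Finset.length_sort, SymPlus.size]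
  have h1 : (S.terms.map fun t : Finset (Fin n) => t.card + 1).sum ≤ S.terms.length * (n + 1) := by
    have := List.sum_le_card_nsmul (S.terms.map fun t : Finset (Fin n) => t.card + 1) (n + 1) (fun x hx => by
      rw [List.mem_map] at hx; obtain ⟨t, -, rfl⟩ := hx; have := hcard t; omega)
    simpa using this
  have h2 : S.terms.length * (n + 2) = S.terms.length * (n + 1) + S.terms.length := by ring
  omega

/-- The monomial bounds behind the time analysis: with `N = 2ⁿ ≥ 1`, `b ≤ s` and
(`b ≤ n + 1` or `N ≤ s`), every monomial of the phase costs is at most a small multiple of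
`Q = (N + s³)(n+1)³`. [folklore] -/
theorem monomial_bounds (N n s b : ℕ) (hN : 1 ≤ N) (hb : b ≤ s) (hcase : b ≤ n + 1 ∨ N ≤ s) :
    let Q := (N + s ^ 3) * (n + 1) ^ 3
    (n + 1) ^ 3 ≤ Q ∧ N * (n + 1) ^ 3 ≤ Q ∧ s ^ 3 * (n + 1) ^ 3 ≤ Q ∧ s ^ 2 * (n + 1) ^ 3 ≤ 2 * Q ∧
      s * (n + 1) ^ 3 ≤ 2 * Q ∧ N * b * (n + 1) ^ 2 ≤ 2 * Q ∧ N * b ^ 2 * (n + 1) ≤ 2 * Q ∧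
      s * b ^ 2 ≤ s ^ 3 ∧ s * b ≤ s ^ 2 ∧ b ^ 2 ≤ s ^ 2 := by
  intro Q
  have hQ : Q = (N + s ^ 3) * (n + 1) ^ 3 := rfl
  have hu : 1 ≤ (n + 1) ^ 3 := Nat.one_le_pow _ _ (Nat.succ_pos n)
  have hu2 : (n + 1) ^ 2 ≤ (n + 1) ^ 3 := Nat.pow_le_pow_right (Nat.succ_pos n) (by norm_num)
  have hu1 : (n + 1) ≤ (n + 1) ^ 3 := by
    calc n + 1 = (n + 1) ^ 1 := (pow_one _).symm
      _ ≤ (n + 1) ^ 3 := Nat.pow_le_pow_right (Nat.succ_pos n) (by norm_num)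
  have hs32 : s ^ 2 ≤ s ^ 3 + 1 := by
    rcases Nat.eq_zero_or_pos s with rfl | hs
    · simp
    · have := Nat.pow_le_pow_right hs (show 2 ≤ 3 by norm_num); omega
  have hs31 : s ≤ s ^ 3 + 1 := by
    rcases Nat.eq_zero_or_pos s with rfl | hs
    · simp
    · have : s ^ 1 ≤ s ^ 3 := Nat.pow_le_pow_right hs (by norm_num); rw [pow_one] at this; omega
  have f0 : (n + 1) ^ 3 ≤ Q := by
    rw [hQ]; calc (n + 1) ^ 3 = 1 * (n + 1) ^ 3 := (one_mul _).symm
      _ ≤ (N + s ^ 3) * (n + 1) ^ 3 := Nat.mul_le_mul_right _ (by omega)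
  have f1 : N * (n + 1) ^ 3 ≤ Q := by rw [hQ]; exact Nat.mul_le_mul_right _ (Nat.le_add_right _ _)
  have f2 : s ^ 3 * (n + 1) ^ 3 ≤ Q := by rw [hQ]; exact Nat.mul_le_mul_right _ (Nat.le_add_left _ _)
  have f3 : s ^ 2 * (n + 1) ^ 3 ≤ 2 * Q := by
    calc s ^ 2 * (n + 1) ^ 3 ≤ (s ^ 3 + 1) * (n + 1) ^ 3 := Nat.mul_le_mul_right _ hs32
      _ = s ^ 3 * (n + 1) ^ 3 + (n + 1) ^ 3 := by ring
      _ ≤ Q + Q := Nat.add_le_add f2 f0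
      _ = 2 * Q := by ring
  have f4 : s * (n + 1) ^ 3 ≤ 2 * Q := by
    calc s * (n + 1) ^ 3 ≤ (s ^ 3 + 1) * (n + 1) ^ 3 := Nat.mul_le_mul_right _ hs31
      _ = s ^ 3 * (n + 1) ^ 3 + (n + 1) ^ 3 := by ring
      _ ≤ Q + Q := Nat.add_le_add f2 f0
      _ = 2 * Q := by ring
  have g1 : s * b ^ 2 ≤ s ^ 3 := by
    calc s * b ^ 2 ≤ s * s ^ 2 := Nat.mul_le_mul_left _ (Nat.pow_le_pow_left hb 2)
      _ = s ^ 3 := by ring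
  have g2 : s * b ≤ s ^ 2 := by rw [pow_two]; exact Nat.mul_le_mul_left _ hb
  have g3 : b ^ 2 ≤ s ^ 2 := Nat.pow_le_pow_left hb 2
  refine ⟨f0, f1, f2, f3, f4, ?_, ?_, g1, g2, g3⟩
  · rcases hcase with h | h
    · calc N * b * (n + 1) ^ 2 ≤ N * (n + 1) * (n + 1) ^ 2 := by gcongr
        _ = N * (n + 1) ^ 3 := by ring
        _ ≤ Q := f1
        _ ≤ 2 * Q := by omega
    · calc N * b * (n + 1) ^ 2 ≤ s * s * (n + 1) ^ 3 := by gcongr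
        _ = s ^ 2 * (n + 1) ^ 3 := by ring
        _ ≤ 2 * Q := f3
  · rcases hcase with h | h
    · calc N * b ^ 2 * (n + 1) ≤ N * (n + 1) ^ 2 * (n + 1) := by gcongr
        _ = N * (n + 1) ^ 3 := by ring
        _ ≤ Q := f1
        _ ≤ 2 * Q := by omega
    · calc N * b ^ 2 * (n + 1) ≤ s * s ^ 2 * (n + 1) ^ 3 := by gcongr
        _ = s ^ 3 * (n + 1) ^ 3 := by ring
        _ ≤ Q := f2
        _ ≤ 2 * Q := by omega

/-- **The total cost is `O((2ⁿ + s³) (n+1)³)`.** [cite: Williams2014, Lemma 4.2] -/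
theorem totalCost_le (S : SymPlus n) : totalCost S + 1 ≤ 30000 * ((2 ^ n + S.size ^ 3) * (n + 1) ^ 3) := by
  have hlen := length_symPlusCodeList S
  have hen : (encodeNat n).length ≤ n := length_encodeNat_le_self n
  have hb : (encodeNat S.size).length ≤ S.size := length_encodeNat_le_self _
  have hcase : (encodeNat S.size).length ≤ n + 1 ∨ 2 ^ n ≤ S.size := by
    rcases lt_or_ge S.size (2 ^ (n + 1)) with h | h
    · exact Or.inl (width_le_of_lt_two_pow h)
    · right; rw [pow_succ] at h; omega
  obtain ⟨f0, f1, f2, f3, f4, f5, f6, g1, g2, g3⟩ :=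
    monomial_bounds (2 ^ n) n S.size (encodeNat S.size).length Nat.one_le_two_pow hb hcase
  have hterms : S.terms.length = S.size := rfl
  unfold totalCost parseCost enumCost enumRoundBound fTableCost runBound zetaCost zetaIter zetaBody roundBound
    joinCost joinBound outCost termBound idxBound width
  rw [hterms]
  generalize (encodeNat S.size).length = b at *
  generalize (encodeNat n).length = en at *
  generalize (symPlusCodeList S).length = len at *
  generalize 2 ^ n = N at *
  generalize S.size = s at *
  have e1 : en * (7 * n + 5) ≤ n * (7 * n + 5) := Nat.mul_le_mul_right _ hen
  have e2 : b * (7 * s + 5) ≤ s * (7 * s + 5) := Nat.mul_le_mul_right _ hb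
  ring_nf at f0 f1 f2 f3 f4 f5 f6 g1 g2 g3 e1 e2 hlen ⊢
  omega

/-- Monotonicity of powers in the exponent, including base `0` (positive exponents). [folklore] -/
theorem pow_mono_exp (s a b : ℕ) (hab : a ≤ b) (ha : 0 < a) : s ^ a ≤ s ^ b := by
  rcases Nat.eq_zero_or_pos s with rfl | hs
  · rw [Nat.zero_pow ha]; exact Nat.zero_le _
  · exact Nat.pow_le_pow_right hs hab

/-- From the cubic bound to the printed shape `c (N + s^c) u^c + c`, for any `c ≥ K`, `c ≥ 3`
(exponents kept symbolic). [folklore] -/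
theorem le_shape (N s u K c : ℕ) (hu : 0 < u) (hc3 : 3 ≤ c) (hK : K ≤ c) :
    K * ((N + s ^ 3) * u ^ 3) ≤ c * (N + s ^ c) * u ^ c + c := by
  have h1 : s ^ 3 ≤ s ^ c := pow_mono_exp s 3 c hc3 (by norm_num)
  have h2 : u ^ 3 ≤ u ^ c := Nat.pow_le_pow_right hu hc3
  calc K * ((N + s ^ 3) * u ^ 3) ≤ c * ((N + s ^ c) * u ^ c) :=
        Nat.mul_le_mul hK (Nat.mul_le_mul (Nat.add_le_add_left h1 _) h2)
    _ = c * (N + s ^ c) * u ^ c := (Nat.mul_assoc _ _ _).symm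
    _ ≤ _ := Nat.le_add_right _ _

end YatesM

/-! ### Williams' Lemma 4.2 -/

/-- **The evaluation lemma, hypothesis-free form** (Williams 2014, Lemma 4.2, by Proof 2 —
Yates' algorithm — implemented on multi-stack machines as in App. C): ONE machine computes the
truth table of every `SYM⁺` circuit `S` with `n` inputs and `s` terms (code `encodeSymPlus S`,
which tabulates the symmetric gate) within `c (2ⁿ + s^c) (n+1)^c + c` steps, with no hypothesis
relating `s` and `n`. This is the hypothesis `hE` of `Williams2014_thm_4_1_of_machines`
(`Williams2014AccSatAssembly.lean`). [cite: Williams2014, Lemma 4.2] -/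
theorem Williams2014_lemma_4_2_strong :
    ∃ (c : ℕ) (E : TM2ComputableAux Bool Bool), ∀ (n : ℕ) (S : SymPlus n),
      E.OutputsWithin (encodeSymPlus S) (MetaComplexity.truthTable S.eval)
        (c * (2 ^ n + S.size ^ c) * (n + 1) ^ c + c) :=
  ⟨30000, YatesM.machine, fun n S => (YatesM.machine_outputsWithin S).mono ((YatesM.totalCost_le S).trans
    (YatesM.le_shape (2 ^ n) S.size (n + 1) 30000 30000 (Nat.succ_pos n) (by norm_num) le_rfl))⟩

/-- **Discharge of the named fact `Williams2014_lemma_4_2`** (Williams 2014, Lemma 4.2: "There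
is an algorithm that, given a `SYM⁺` circuit of size `s ≤ 2^{0.1 n}` and `n` inputs with a
symmetric function that can be evaluated in `poly(s)` time, runs in `(2ⁿ + poly(s)) · poly(n)`
time and prints a `2ⁿ`-bit vector `V` which is the truth table of the function represented by
the given circuit"), from the hypothesis-free form (the printed size hypothesis, needed by
Proof 1 only, is not used). [cite: Williams2014, Lemma 4.2] -/
theorem Williams2014_lemma_4_2_holds : Williams2014_lemma_4_2 := by
  obtain ⟨c, E, h⟩ := Williams2014_lemma_4_2_strong
  exact ⟨c, E, fun n S _ => h n S⟩

namespace YatesM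
end YatesM

end Literature.Computability.Complexity
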